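import Summits.CriticalPhenomena.Ising3DConformalLimit.Theorems.CoerciveSharpnessPhiCoerciveFreeHeatBath
import Literature.Probability.LatticeModels.LebowitzPairTruncationIsing
import Literature.Probability.LatticeModels.GriffithsMonotonicity
import Literature.Probability.LatticeModels.SharpLengthDCPProofs
import HarnessLib

/-!
# Creation of flux at low-coordination sites
(crux `CoerciveSharpness.PhiCoercive`, item stmt-CriticalPhenomena-18196, line `box-superset`;
helper stub `stub_lowCoordinationCreation`, idea `surface-creation-superharmonicity`)

Finite volume `Λ`, free boundary condition, zero field, `β ≥ 0`, base point `o ∈ Λ`, a site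
`x ∈ Λ`, `x ≠ o`, with `k ≤ 4` neighbours `N = {y ∼ x : y ∈ Λ}` inside `Λ` whose mutual pair
correlations are `≤ 1/3`. Then, with `u(y) = ⟨σ_oσ_y⟩^free_Λ`: `tanh(4β)/4 · Σ_{y ∈ N} u(y) ≤ u(x)`.

## Proof

* heat bath (one-site DLR identity, `isingExpect_spinAt_mul_eq_tanh_free`):
  `u(x) = ⟨σ_o tanh(β h_x)⟩`, `h_x = Σ_{y ∈ N} σ_y`;
* the odd function `tanh(β h)` of `k ≤ 4` spins `±1` is EXACTLY `a₁ h + a₃ e₃`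
  (`e₃` = third elementary symmetric polynomial of the spins), with
  `k = 1`: `a₁ = tanh β`; `k = 2`: `a₁ = tanh(2β)/2`; `k = 3`: `a₁ = (tanh 3β + tanh β)/4`,
  `a₃ = (tanh 3β - 3 tanh β)/4 ≤ 0`; `k = 4`: `a₁ = tanh(4β)/8 + tanh(2β)/4`,
  `a₃ = tanh(4β)/8 - tanh(2β)/4 ≤ 0` (case analysis on the spin values);
* Lebowitz' inequality `u₄ ≤ 0` (`lebowitz_holds`, Glimm–Jaffe Cor. 4.3.3) and the pair bounds give
  `⟨σ_o σ_i σ_j σ_l⟩ ≤ (u(i) + u(j) + u(l))/3`, whence `⟨σ_o e₃⟩ ≤ ⟨σ_o h⟩/3` (`k = 3`) and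
  `⟨σ_o e₃⟩ ≤ ⟨σ_o h⟩` (`k = 4`);
* so `u(x) ≥ (tanh(kβ)/k) ⟨σ_o h⟩ ≥ (tanh(4β)/4) ⟨σ_o h⟩`, the last step because `tanh w / w` is
  non-increasing on `(0, ∞)` (concavity of `tanh` on `[0, ∞)`).

References: J. Glimm, A. Jaffe, *Quantum Physics*, 2nd ed. (Springer 1987), §4.3, Cor. 4.3.3
[GlimmJaffe1987]; S. Friedli, Y. Velenik, *Statistical Mechanics of Lattice Systems* (CUP 2017),
Lemma 6.7 / Exercise 3.11 (heat bath), Thm. 3.20 (GKS) [FriedliVelenik2017].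
-/

noncomputable section

namespace Summit.CriticalPhenomena.Ising3DConformalLimit.Cruxes.PhiCoercive.BoxSuperset

open scoped BigOperators
open Finset
open Literature.Probability.LatticeModels

/-! ### `tanh w / w` is non-increasing on `(0, ∞)` -/

/-- `tanh' = 1/cosh²`. [folklore] -/
private theorem hasDerivAt_real_tanh (x : ℝ) : HasDerivAt Real.tanh (1 / Real.cosh x ^ 2) x := by
  -- adapted from Cruxes/TwSourcedCondensation/Disproof.lean (HubbardSuperconductivity)
  have hc : Real.cosh x ≠ 0 := (Real.cosh_pos x).ne'
  have h := (Real.hasDerivAt_sinh x).div (Real.hasDerivAt_cosh x) hc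
  have heq : (Real.sinh / Real.cosh : ℝ → ℝ) = Real.tanh := by
    funext y; simp [Real.tanh_eq_sinh_div_cosh]
  rw [heq] at h
  have h1 : Real.cosh x * Real.cosh x - Real.sinh x * Real.sinh x = 1 := by
    have := Real.cosh_sq_sub_sinh_sq x
    nlinarith
  refine h.congr_deriv ?_
  rw [h1]

/-- `tanh` is concave on `[0, ∞)` (its derivative `1/cosh²` is non-increasing there). [folklore] -/
private theorem concaveOn_tanh_Ici : ConcaveOn ℝ (Set.Ici (0 : ℝ)) Real.tanh := by
  -- adapted from Cruxes/TwSourcedCondensation/Disproof.lean (HubbardSuperconductivity)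
  have hcont : Continuous Real.tanh :=
    continuous_iff_continuousAt.2 fun x => (hasDerivAt_real_tanh x).continuousAt
  refine AntitoneOn.concaveOn_of_deriv (convex_Ici 0) hcont.continuousOn
    (fun x _ => (hasDerivAt_real_tanh x).differentiableAt.differentiableWithinAt) ?_
  rw [interior_Ici]
  intro x hx y hy hxy
  rw [(hasDerivAt_real_tanh x).deriv, (hasDerivAt_real_tanh y).deriv]
  have hx0 : 0 < x := hx
  have hy0 : 0 < y := hy
  apply one_div_le_one_div_of_le (pow_pos (Real.cosh_pos x) 2)
  exact pow_le_pow_left₀ (Real.cosh_pos x).le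
    (Real.cosh_le_cosh.2 (by rw [abs_of_pos hx0, abs_of_pos hy0]; exact hxy)) 2

/-- `tanh w / w` is non-increasing on `(0, ∞)`. [folklore] -/
private theorem tanh_div_le_tanh_div {a b : ℝ} (ha : 0 < a) (hab : a ≤ b) :
    Real.tanh b / b ≤ Real.tanh a / a := by
  -- adapted from Cruxes/TwSourcedCondensation/Disproof.lean (HubbardSuperconductivity)
  rcases hab.eq_or_lt with rfl | hlt
  · exact le_rfl
  have hb : 0 < b := ha.trans hlt
  have hconv : ConvexOn ℝ (Set.Ici (0 : ℝ)) (-Real.tanh) := concaveOn_tanh_Ici.neg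
  have key := hconv.secant_mono (a := 0) (x := a) (y := b) Set.self_mem_Ici
    (Set.mem_Ici.2 ha.le) (Set.mem_Ici.2 hb.le) ha.ne' hb.ne' hab
  simp only [Pi.neg_apply, Real.tanh_zero, neg_zero, sub_zero] at key
  rw [neg_div, neg_div] at key
  linarith

/-- `a tanh(b β) ≤ b tanh(a β)` for `0 < a ≤ b`, `β ≥ 0`, i.e. `tanh(nβ)/n` is non-increasing
in `n`. [folklore] -/
private theorem mul_tanh_mul_le {a b β : ℝ} (ha : 0 < a) (hab : a ≤ b) (hβ : 0 ≤ β) :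
    a * Real.tanh (b * β) ≤ b * Real.tanh (a * β) := by
  rcases hβ.eq_or_lt with rfl | hβ'
  · simp
  have hb : 0 < b := ha.trans_le hab
  have h := tanh_div_le_tanh_div (mul_pos ha hβ') (mul_le_mul_of_nonneg_right hab hβ'.le)
  rw [div_le_div_iff₀ (mul_pos hb hβ') (mul_pos ha hβ')] at h
  have h2 : β * (a * Real.tanh (b * β)) ≤ β * (b * Real.tanh (a * β)) := by linarith
  exact le_of_mul_le_mul_left h2 hβ'

/-! ### Exact expansions of `tanh(β h)` for `h` a sum of `k ≤ 4` spins `±1` -/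

/-- `k = 1`: `tanh(β s) = tanh β · s` for `s = ±1`. [folklore] -/
private theorem tanh_spin_one (β : ℝ) {s : ℝ} (hs : s = 1 ∨ s = -1) :
    Real.tanh (β * s) = Real.tanh β * s := by
  rcases hs with rfl | rfl <;> simp

/-- `k = 2`: `tanh(β(s + t)) = (tanh 2β / 2)(s + t)` for `s, t = ±1`. [folklore] -/
private theorem tanh_spin_two (β : ℝ) {s t : ℝ} (hs : s = 1 ∨ s = -1) (ht : t = 1 ∨ t = -1) :
    Real.tanh (β * (s + t)) = Real.tanh (2 * β) / 2 * (s + t) := by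
  rcases hs with rfl | rfl <;> rcases ht with rfl | rfl <;> ring_nf <;> simp [Real.tanh_neg]

/-- `k = 3`: `tanh(β h) = a₁ h + a₃ s t r`, `h = s + t + r`, for `s, t, r = ±1`. [folklore] -/
private theorem tanh_spin_three (β : ℝ) {s t r : ℝ} (hs : s = 1 ∨ s = -1) (ht : t = 1 ∨ t = -1)
    (hr : r = 1 ∨ r = -1) :
    Real.tanh (β * (s + (t + r))) =
      (Real.tanh (3 * β) + Real.tanh β) / 4 * (s + (t + r)) +
        (Real.tanh (3 * β) - 3 * Real.tanh β) / 4 * (s * t * r) := by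
  rcases hs with rfl | rfl <;> rcases ht with rfl | rfl <;> rcases hr with rfl | rfl <;> ring_nf <;>
    simp [Real.tanh_neg]

/-- `k = 4`: `tanh(β h) = a₁ h + a₃ e₃`, `h = s + t + r + q`, `e₃` the third elementary symmetric
polynomial, for `s, t, r, q = ±1`. [folklore] -/
private theorem tanh_spin_four (β : ℝ) {s t r q : ℝ} (hs : s = 1 ∨ s = -1) (ht : t = 1 ∨ t = -1)
    (hr : r = 1 ∨ r = -1) (hq : q = 1 ∨ q = -1) :
    Real.tanh (β * (s + (t + (r + q)))) =
      (Real.tanh (4 * β) / 8 + Real.tanh (2 * β) / 4) * (s + (t + (r + q))) +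
        (Real.tanh (4 * β) / 8 - Real.tanh (2 * β) / 4) *
          (s * t * r + s * t * q + s * r * q + t * r * q) := by
  rcases hs with rfl | rfl <;> rcases ht with rfl | rfl <;> rcases hr with rfl | rfl <;>
    rcases hq with rfl | rfl <;> ring_nf <;> simp [Real.tanh_neg]

/-! ### Expectations: GKS I, Lebowitz, linearity -/

variable {V : Type*} [DecidableEq V] (G : SimpleGraph V) [G.LocallyFinite]

/-- `0 ≤ ⟨σ_xσ_y⟩^free_{Λ;β,0}` for `β ≥ 0`, `x, y ∈ Λ` (GKS I, `GKSInequalities.gks_one_holds`).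
[cite: FriedliVelenik2017, Theorem 3.20] -/
private theorem twoPoint_free_nonneg {β : ℝ} (hβ : 0 ≤ β) {Λ : Finset V} {x y : V} (hx : x ∈ Λ)
    (hy : y ∈ Λ) : 0 ≤ isingTwoPoint G Λ β 0 .free x y := by
  -- adapted from `isingTwoPoint_free_nonneg_of_mem` (CriticalTwoPointDCPLowerTorus.lean)
  by_cases hxy : x = y
  · subst hxy; simp
  rw [isingTwoPoint_eq_isingCorr _ _ _ _ _ hxy]
  refine GKSInequalities.gks_one_holds G hβ le_rfl (Or.inl rfl) ?_
  intro w hw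
  simp only [mem_insert, mem_singleton] at hw
  rcases hw with rfl | rfl
  · exact hx
  · exact hy

/-- **Lebowitz' inequality** `u₄ ≤ 0` (`lebowitz_holds`; Glimm–Jaffe 1987, Cor. 4.3.3), free
boundary condition, zero field, `β ≥ 0`, for four (not necessarily distinct) sites of `Λ`:
`⟨σ_oσ_aσ_bσ_c⟩ ≤ ⟨σ_oσ_a⟩⟨σ_bσ_c⟩ + ⟨σ_oσ_b⟩⟨σ_aσ_c⟩ + ⟨σ_oσ_c⟩⟨σ_aσ_b⟩`.
[cite: GlimmJaffe1987, Cor. 4.3.3] -/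
private theorem four_le {β : ℝ} (hβ : 0 ≤ β) (Λ : Finset V) {o a b c : V} (ho : o ∈ Λ)
    (ha : a ∈ Λ) (hb : b ∈ Λ) (hc : c ∈ Λ) :
    isingExpect G Λ β 0 .free (fun σ => spinAt o σ * spinAt a σ * spinAt b σ * spinAt c σ) ≤
      isingTwoPoint G Λ β 0 .free o a * isingTwoPoint G Λ β 0 .free b c +
        isingTwoPoint G Λ β 0 .free o b * isingTwoPoint G Λ β 0 .free a c +
          isingTwoPoint G Λ β 0 .free o c * isingTwoPoint G Λ β 0 .free a b := by
  have hx : ∀ i, (![o, a, b, c] : Fin 4 → V) i ∈ Λ := by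
    intro i
    fin_cases i <;> simp [ho, ha, hb, hc]
  have key := lebowitz_holds G hβ Λ ![o, a, b, c] hx
  have hn : nPoint (isingMeasure G Λ β 0 .free) spinAt ![o, a, b, c] =
      isingExpect G Λ β 0 .free (fun σ => spinAt o σ * spinAt a σ * spinAt b σ * spinAt c σ) := by
    simp [nPoint, isingExpect, Fin.prod_univ_four]
  have ht : ∀ p q, twoPoint (isingMeasure G Λ β 0 .free) spinAt p q =
      isingTwoPoint G Λ β 0 .free p q := fun _ _ => rfl
  have e0 : (![o, a, b, c] : Fin 4 → V) 0 = o := rfl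
  have e1 : (![o, a, b, c] : Fin 4 → V) 1 = a := rfl
  have e2 : (![o, a, b, c] : Fin 4 → V) 2 = b := rfl
  have e3 : (![o, a, b, c] : Fin 4 → V) 3 = c := rfl
  simp only [connectedFour, hn, ht, e0, e1, e2, e3] at key
  linarith

/-- Lebowitz plus the pair bounds `⟨σ_aσ_b⟩, ⟨σ_aσ_c⟩, ⟨σ_bσ_c⟩ ≤ 1/3` and GKS I:
`⟨σ_oσ_aσ_bσ_c⟩ ≤ (⟨σ_oσ_a⟩ + ⟨σ_oσ_b⟩ + ⟨σ_oσ_c⟩)/3`. [cite: GlimmJaffe1987, Cor. 4.3.3] -/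
private theorem four_le_third {β : ℝ} (hβ : 0 ≤ β) {Λ : Finset V} {o a b c : V} (ho : o ∈ Λ)
    (ha : a ∈ Λ) (hb : b ∈ Λ) (hc : c ∈ Λ) (hab : isingTwoPoint G Λ β 0 .free a b ≤ 1 / 3)
    (hac : isingTwoPoint G Λ β 0 .free a c ≤ 1 / 3)
    (hbc : isingTwoPoint G Λ β 0 .free b c ≤ 1 / 3) :
    isingExpect G Λ β 0 .free (fun σ => spinAt o σ * spinAt a σ * spinAt b σ * spinAt c σ) ≤
      1 / 3 * (isingTwoPoint G Λ β 0 .free o a + isingTwoPoint G Λ β 0 .free o b +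
        isingTwoPoint G Λ β 0 .free o c) := by
  have h := four_le G hβ Λ ho ha hb hc
  have h1 := mul_le_mul_of_nonneg_left hbc (twoPoint_free_nonneg G hβ ho ha)
  have h2 := mul_le_mul_of_nonneg_left hac (twoPoint_free_nonneg G hβ ho hb)
  have h3 := mul_le_mul_of_nonneg_left hab (twoPoint_free_nonneg G hβ ho hc)
  linarith

omit [DecidableEq V] in
/-- A product of four spins is measurable. [folklore] -/
private theorem measurable_four (o a b c : V) :
    Measurable fun σ : SpinConfig V => spinAt o σ * spinAt a σ * spinAt b σ * spinAt c σ := by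
  fun_prop [measurable_spinAt]

omit [DecidableEq V] in
/-- `σ_o · Σ_{y ∈ N} σ_y` is measurable. [folklore] -/
private theorem measurable_spin_mul_sum (o : V) (N : Finset V) :
    Measurable fun σ : SpinConfig V => spinAt o σ * ∑ y ∈ N, spinAt y σ :=
  (measurable_spinAt o).mul (Finset.measurable_sum N fun y _ => measurable_spinAt y)

/-- `⟨a f + b g⟩ = a⟨f⟩ + b⟨g⟩` for measurable `f, g`. [folklore] -/
private theorem expect_lin (Λ : Finset V) (β : ℝ) {f g : SpinConfig V → ℝ} (hf : Measurable f)
    (hg : Measurable g) (a b : ℝ) :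
    isingExpect G Λ β 0 .free (fun σ => a * f σ + b * g σ) =
      a * isingExpect G Λ β 0 .free f + b * isingExpect G Λ β 0 .free g := by
  rw [isingExpect_add' G Λ 0 .free β (hf.const_mul a) (hg.const_mul b),
    isingExpect_const_mul' G Λ 0 .free β a hf, isingExpect_const_mul' G Λ 0 .free β b hg]

/-- `⟨a f + b (g₁ + g₂ + g₃ + g₄)⟩ = a⟨f⟩ + b(⟨g₁⟩ + ⟨g₂⟩ + ⟨g₃⟩ + ⟨g₄⟩)` for measurable
`f, gᵢ`. [folklore] -/
private theorem expect_lin_four (Λ : Finset V) (β : ℝ) {f g₁ g₂ g₃ g₄ : SpinConfig V → ℝ}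
    (hf : Measurable f) (h₁ : Measurable g₁) (h₂ : Measurable g₂) (h₃ : Measurable g₃)
    (h₄ : Measurable g₄) (a b : ℝ) :
    isingExpect G Λ β 0 .free (fun σ => a * f σ + b * (g₁ σ + g₂ σ + g₃ σ + g₄ σ)) =
      a * isingExpect G Λ β 0 .free f + b * (isingExpect G Λ β 0 .free g₁ +
        isingExpect G Λ β 0 .free g₂ + isingExpect G Λ β 0 .free g₃ +
          isingExpect G Λ β 0 .free g₄) := by
  have h12 : Measurable fun σ => g₁ σ + g₂ σ := h₁.add h₂
  have h123 : Measurable fun σ => g₁ σ + g₂ σ + g₃ σ := h12.add h₃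
  have h1234 : Measurable fun σ => g₁ σ + g₂ σ + g₃ σ + g₄ σ := h123.add h₄
  rw [expect_lin G Λ β hf h1234, isingExpect_add' G Λ 0 .free β h123 h₄,
    isingExpect_add' G Λ 0 .free β h12 h₃, isingExpect_add' G Λ 0 .free β h₁ h₂]

/-- `⟨σ_o Σ_{y ∈ N} σ_y⟩ = Σ_{y ∈ N} ⟨σ_oσ_y⟩`. [folklore] -/
private theorem expect_spin_mul_sum (Λ N : Finset V) (β : ℝ) (o : V) :
    isingExpect G Λ β 0 .free (fun σ => spinAt o σ * ∑ y ∈ N, spinAt y σ) =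
      ∑ y ∈ N, isingTwoPoint G Λ β 0 .free o y := by
  simp_rw [Finset.mul_sum]
  rw [isingExpect_finset_sum' G Λ 0 .free β N (fun y σ => spinAt o σ * spinAt y σ)
    fun y => (measurable_spinAt o).mul (measurable_spinAt y)]
  rfl

/-! ### The creation bound -/

/-- **Creation of flux at low-coordination sites** (any locally finite graph, free boundary
condition, zero field, `β ≥ 0`). If `x ≠ o` has `k ≤ 4` neighbours inside `Λ` whose mutual pair
correlations are `≤ 1/3`, then `tanh(4β)/4 · Σ_{y ∼ x, y ∈ Λ} ⟨σ_oσ_y⟩ ≤ ⟨σ_oσ_x⟩`: heat bath,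
exact expansion of `tanh(β h_x)` in odd symmetric spin polynomials, Lebowitz for the cubic term,
and `tanh(kβ)/k ≥ tanh(4β)/4`. [cite: GlimmJaffe1987, Cor. 4.3.3]
[cite: FriedliVelenik2017, Lemma 6.7] -/
theorem tanh_mul_sum_twoPoint_le_of_card_filter_le_four {β : ℝ} (hβ : 0 ≤ β) {Λ : Finset V}
    {o x : V} (ho : o ∈ Λ) (hx : x ∈ Λ) (hxo : x ≠ o)
    (hk : ((G.neighborFinset x).filter (fun y => y ∈ Λ)).card ≤ 4)
    (hp : ∀ y ∈ (G.neighborFinset x).filter (fun y => y ∈ Λ),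
      ∀ y' ∈ (G.neighborFinset x).filter (fun y => y ∈ Λ), y ≠ y' →
        isingTwoPoint G Λ β 0 .free y y' ≤ 1 / 3) :
    Real.tanh (4 * β) / 4 *
        ∑ y ∈ (G.neighborFinset x).filter (fun y => y ∈ Λ), isingTwoPoint G Λ β 0 .free o y ≤
      isingTwoPoint G Λ β 0 .free o x := by
  -- heat bath: `u(x) = ⟨tanh(β h_x) σ_o⟩`
  have hhb : isingTwoPoint G Λ β 0 .free o x = isingExpect G Λ β 0 .free (fun σ =>
      Real.tanh (β * ∑ y ∈ (G.neighborFinset x).filter (fun y => y ∈ Λ), spinAt y σ) *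
        spinAt o σ) := by
    rw [← isingExpect_spinAt_mul_eq_tanh_free G hx β (measurable_spinAt o)
      (fun σ u => by unfold spinAt; rw [Function.update_of_ne hxo.symm])]
    show isingExpect G Λ β 0 .free (spinPair o x) = _
    congr 1
    funext σ
    simp only [spinPair]
    ring
  set N := (G.neighborFinset x).filter (fun y => y ∈ Λ) with hN
  have hNΛ : ∀ y ∈ N, y ∈ Λ := fun y hy => (mem_filter.1 hy).2
  have hs : ∀ (y : V) (σ : SpinConfig V), spinAt y σ = 1 ∨ spinAt y σ = -1 :=
    spinAt_eq_one_or_eq_neg_one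
  have hU : 0 ≤ ∑ y ∈ N, isingTwoPoint G Λ β 0 .free o y :=
    sum_nonneg fun y hy => twoPoint_free_nonneg G hβ ho (hNΛ y hy)
  obtain h0 | h1 | h2 | h3 | h4 : N.card = 0 ∨ N.card = 1 ∨ N.card = 2 ∨ N.card = 3 ∨
      N.card = 4 := by omega
  · -- `k = 0`: the sum is empty, the claim is GKS I
    rw [card_eq_zero.1 h0, sum_empty, mul_zero]
    exact twoPoint_free_nonneg G hβ ho hx
  · -- `k = 1`: `u(x) = tanh β · u(y₁)`
    obtain ⟨y₁, hN1⟩ := card_eq_one.1 h1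
    have hpt : (fun σ => Real.tanh (β * ∑ y ∈ N, spinAt y σ) * spinAt o σ) =
        fun σ => Real.tanh β * (spinAt o σ * ∑ y ∈ N, spinAt y σ) := by
      funext σ
      rw [hN1, sum_singleton, tanh_spin_one β (hs y₁ σ)]
      ring
    rw [hhb, hpt, isingExpect_const_mul' G Λ 0 .free β _ (measurable_spin_mul_sum o N),
      expect_spin_mul_sum]
    have h14 := mul_tanh_mul_le one_pos (by norm_num : (1 : ℝ) ≤ 4) hβ
    simp only [one_mul] at h14
    nlinarith [mul_le_mul_of_nonneg_right h14 hU]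
  · -- `k = 2`: `u(x) = (tanh 2β / 2)(u(y₁) + u(y₂))`
    obtain ⟨y₁, y₂, h12, hN2⟩ := card_eq_two.1 h2
    have hpt : (fun σ => Real.tanh (β * ∑ y ∈ N, spinAt y σ) * spinAt o σ) =
        fun σ => Real.tanh (2 * β) / 2 * (spinAt o σ * ∑ y ∈ N, spinAt y σ) := by
      funext σ
      rw [hN2, sum_pair h12, tanh_spin_two β (hs y₁ σ) (hs y₂ σ)]
      ring
    rw [hhb, hpt, isingExpect_const_mul' G Λ 0 .free β _ (measurable_spin_mul_sum o N),
      expect_spin_mul_sum]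
    have h24 := mul_tanh_mul_le two_pos (by norm_num : (2 : ℝ) ≤ 4) hβ
    nlinarith [mul_le_mul_of_nonneg_right h24 hU]
  · -- `k = 3`: `u(x) = a₁ ⟨σ_o h⟩ + a₃ ⟨σ_oσ₁σ₂σ₃⟩ ≥ (tanh 3β / 3) ⟨σ_o h⟩`
    obtain ⟨y₁, y₂, y₃, h12, h13, h23, hN3⟩ := card_eq_three.1 h3
    have hy₁ : y₁ ∈ N := by rw [hN3]; simp
    have hy₂ : y₂ ∈ N := by rw [hN3]; simp
    have hy₃ : y₃ ∈ N := by rw [hN3]; simp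
    have hy₁' : y₁ ∉ ({y₂, y₃} : Finset V) := by simp [h12, h13]
    have hsum : ∀ σ : SpinConfig V, ∑ y ∈ N, spinAt y σ =
        spinAt y₁ σ + (spinAt y₂ σ + spinAt y₃ σ) := fun σ => by
      rw [hN3, sum_insert hy₁', sum_pair h23]
    have hpt : (fun σ => Real.tanh (β * ∑ y ∈ N, spinAt y σ) * spinAt o σ) = fun σ =>
        (Real.tanh (3 * β) + Real.tanh β) / 4 * (spinAt o σ * ∑ y ∈ N, spinAt y σ) +
          (Real.tanh (3 * β) - 3 * Real.tanh β) / 4 *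
            (spinAt o σ * spinAt y₁ σ * spinAt y₂ σ * spinAt y₃ σ) := by
      funext σ
      rw [hsum σ, tanh_spin_three β (hs y₁ σ) (hs y₂ σ) (hs y₃ σ)]
      ring
    rw [hhb, hpt, expect_lin G Λ β (measurable_spin_mul_sum o N) (measurable_four o y₁ y₂ y₃),
      expect_spin_mul_sum]
    have hg := four_le_third G hβ ho (hNΛ _ hy₁) (hNΛ _ hy₂) (hNΛ _ hy₃) (hp _ hy₁ _ hy₂ h12)
      (hp _ hy₁ _ hy₃ h13) (hp _ hy₂ _ hy₃ h23)
    have hUeq : ∑ y ∈ N, isingTwoPoint G Λ β 0 .free o y = isingTwoPoint G Λ β 0 .free o y₁ +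
        (isingTwoPoint G Λ β 0 .free o y₂ + isingTwoPoint G Λ β 0 .free o y₃) := by
      rw [hN3, sum_insert hy₁', sum_pair h23]
    have h13' := mul_tanh_mul_le one_pos (by norm_num : (1 : ℝ) ≤ 3) hβ
    simp only [one_mul] at h13'
    have h34 := mul_tanh_mul_le (by norm_num : (0 : ℝ) < 3) (by norm_num : (3 : ℝ) ≤ 4) hβ
    have hB : (Real.tanh (3 * β) - 3 * Real.tanh β) / 4 ≤ 0 := by linarith
    have hprod := mul_le_mul_of_nonpos_left hg hB
    have hcmp := mul_le_mul_of_nonneg_right h34 hU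
    rw [hUeq] at hcmp ⊢
    linarith
  · -- `k = 4`: `u(x) = a₁ ⟨σ_o h⟩ + a₃ ⟨σ_o e₃⟩ ≥ (a₁ + a₃) ⟨σ_o h⟩ = (tanh 4β / 4) ⟨σ_o h⟩`
    obtain ⟨y₁, t, hy₁t, hNt, ht3⟩ := card_eq_succ.1 h4
    obtain ⟨y₂, y₃, y₄, h23, h24, h34, rfl⟩ := card_eq_three.1 ht3
    simp only [mem_insert, mem_singleton, not_or] at hy₁t
    obtain ⟨h12, h13, h14⟩ := hy₁t
    have hN4 : N = {y₁, y₂, y₃, y₄} := hNt.symm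
    have hy₁ : y₁ ∈ N := by rw [hN4]; simp
    have hy₂ : y₂ ∈ N := by rw [hN4]; simp
    have hy₃ : y₃ ∈ N := by rw [hN4]; simp
    have hy₄ : y₄ ∈ N := by rw [hN4]; simp
    have hy₁' : y₁ ∉ ({y₂, y₃, y₄} : Finset V) := by simp [h12, h13, h14]
    have hy₂' : y₂ ∉ ({y₃, y₄} : Finset V) := by simp [h23, h24]
    have hsum : ∀ σ : SpinConfig V, ∑ y ∈ N, spinAt y σ =
        spinAt y₁ σ + (spinAt y₂ σ + (spinAt y₃ σ + spinAt y₄ σ)) := fun σ => by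
      rw [hN4, sum_insert hy₁', sum_insert hy₂', sum_pair h34]
    have hpt : (fun σ => Real.tanh (β * ∑ y ∈ N, spinAt y σ) * spinAt o σ) = fun σ =>
        (Real.tanh (4 * β) / 8 + Real.tanh (2 * β) / 4) * (spinAt o σ * ∑ y ∈ N, spinAt y σ) +
          (Real.tanh (4 * β) / 8 - Real.tanh (2 * β) / 4) *
            (spinAt o σ * spinAt y₁ σ * spinAt y₂ σ * spinAt y₃ σ +
              spinAt o σ * spinAt y₁ σ * spinAt y₂ σ * spinAt y₄ σ +
              spinAt o σ * spinAt y₁ σ * spinAt y₃ σ * spinAt y₄ σ +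
              spinAt o σ * spinAt y₂ σ * spinAt y₃ σ * spinAt y₄ σ) := by
      funext σ
      rw [hsum σ, tanh_spin_four β (hs y₁ σ) (hs y₂ σ) (hs y₃ σ) (hs y₄ σ)]
      ring
    rw [hhb, hpt, expect_lin_four G Λ β (measurable_spin_mul_sum o N) (measurable_four o y₁ y₂ y₃)
      (measurable_four o y₁ y₂ y₄) (measurable_four o y₁ y₃ y₄) (measurable_four o y₂ y₃ y₄),
      expect_spin_mul_sum]
    have g₁ := four_le_third G hβ ho (hNΛ _ hy₁) (hNΛ _ hy₂) (hNΛ _ hy₃) (hp _ hy₁ _ hy₂ h12)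
      (hp _ hy₁ _ hy₃ h13) (hp _ hy₂ _ hy₃ h23)
    have g₂ := four_le_third G hβ ho (hNΛ _ hy₁) (hNΛ _ hy₂) (hNΛ _ hy₄) (hp _ hy₁ _ hy₂ h12)
      (hp _ hy₁ _ hy₄ h14) (hp _ hy₂ _ hy₄ h24)
    have g₃ := four_le_third G hβ ho (hNΛ _ hy₁) (hNΛ _ hy₃) (hNΛ _ hy₄) (hp _ hy₁ _ hy₃ h13)
      (hp _ hy₁ _ hy₄ h14) (hp _ hy₃ _ hy₄ h34)
    have g₄ := four_le_third G hβ ho (hNΛ _ hy₂) (hNΛ _ hy₃) (hNΛ _ hy₄) (hp _ hy₂ _ hy₃ h23)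
      (hp _ hy₂ _ hy₄ h24) (hp _ hy₃ _ hy₄ h34)
    have hUeq : ∑ y ∈ N, isingTwoPoint G Λ β 0 .free o y = isingTwoPoint G Λ β 0 .free o y₁ +
        (isingTwoPoint G Λ β 0 .free o y₂ + (isingTwoPoint G Λ β 0 .free o y₃ +
          isingTwoPoint G Λ β 0 .free o y₄)) := by
      rw [hN4, sum_insert hy₁', sum_insert hy₂', sum_pair h34]
    have h24' := mul_tanh_mul_le two_pos (by norm_num : (2 : ℝ) ≤ 4) hβ
    have hB : Real.tanh (4 * β) / 8 - Real.tanh (2 * β) / 4 ≤ 0 := by linarith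
    have hprod :=
      mul_le_mul_of_nonpos_left (add_le_add (add_le_add (add_le_add g₁ g₂) g₃) g₄) hB
    rw [hUeq]
    linarith

/-- **Stub `stub_lowCoordinationCreation` (line `box-superset` of crux `PhiCoercive`): creation of
flux at low-coordination sites of `ℤ³`.** For `β ≥ 0`, `0, x ∈ S`, `x ≠ 0`, with at most `4`
neighbours of `x` in `S` whose mutual pair correlations are `≤ 1/3`:
`tanh(4β)/4 · Σ_{y ∼ x, y ∈ S} ⟨σ₀σ_y⟩^free_S ≤ ⟨σ₀σ_x⟩^free_S`
(`tanh_mul_sum_twoPoint_le_of_card_filter_le_four` for `G = ℤ³`, `o = 0`).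
[cite: GlimmJaffe1987, Cor. 4.3.3] [cite: FriedliVelenik2017, Lemma 6.7] -/
theorem stub_lowCoordinationCreation : ∀ (β : ℝ), 0 ≤ β → ∀ (S : Finset (Site 3)) (x : Site 3),
    (0 : Site 3) ∈ S → x ∈ S → x ≠ 0 →
    (((zdGraph 3).neighborFinset x).filter (fun y => y ∈ S)).card ≤ 4 →
    (∀ y ∈ ((zdGraph 3).neighborFinset x).filter (fun y => y ∈ S),
      ∀ y' ∈ ((zdGraph 3).neighborFinset x).filter (fun y => y ∈ S), y ≠ y' →
        isingTwoPoint (zdGraph 3) S β 0 .free y y' ≤ 1 / 3) →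
    Real.tanh (4 * β) / 4 *
        ∑ y ∈ ((zdGraph 3).neighborFinset x).filter (fun y => y ∈ S),
          isingTwoPoint (zdGraph 3) S β 0 .free 0 y ≤
      isingTwoPoint (zdGraph 3) S β 0 .free 0 x :=
  fun _ hβ _ _ h0 hx hx0 hk hp =>
    tanh_mul_sum_twoPoint_le_of_card_filter_le_four (zdGraph 3) hβ h0 hx hx0 hk hp

end Summit.CriticalPhenomena.Ising3DConformalLimit.Cruxes.PhiCoercive.BoxSuperset

end
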